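/-
Origin: expansion seat `planner-pub-hodgecm-pv08-0`, handover 2026-08-18T03:27:40Z (`HOME/pub-hodgecm-pv08/lean/Pv08/P43Membership.lean`, md5 42bd54fa, 230 lines);
landed by the gen-5 packager in gate run 18 as `HodgeCM/PerL34/P43_membership.lean` (run-18 rename map ×1).
-/
/-
Origin: HOME/pub-hodgecm-pv08/lean/Pv08/P43Membership.lean — session planner-pub-hodgecm-pv08-0 (unit
pub-hodgecm-pv08, DAG-NODE PROVER #08).  Intended final place: `HodgeCM/PerL34/P43_membership.lean` (the carver's
stub name for node N33d, HOME/LEMMAS.md §1 row N33d).  DAG node: **N33d** = PerL v5 Prop 4.3 (`prop:S12`) proof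
step, tex ll. 660–667 — the R1 first-error repair site ("the wedge has no proven membership in `S₁₂`", repaired in
v2 exactly here: membership for the FIXED lines).  No input is minted: every hypothesis of the
theorems below is EITHER an earlier DAG node's statement typed verbatim (N31 = Lemma 4.2(b) output, N19 = Lemma 3.5
wedge direction, N33b = holomorphy of `u_f`) OR one of the package's PRINT facts (`Universe.Fact_hodgeRiemann20`,
Voisin I Thm 6.32; `ThetaModel.Fact_innerEmb`, Matsushima / [BW] VII Thm 3.2) OR the model axioms `ModelAxioms`.
-/
import Summits.HodgeConjecture.HodgeCM.Proofs.RealisationConstruction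

set_option autoImplicit false

/-!
# PerL v5 Prop 4.3, proof step ll. 660–667 (DAG node N33d): wedges of theta one-forms lie in `S₁₂`

Verbatim (tex ll. 660–667):

> Every pair `(\chi'_1,\chi'_2)` of such characters gives an allowed pair `((W_1,\mu_1,\chi'_1),(W_2,\mu_2,\chi'_2))`
> for the FIXED lines and splitting characters (`\mu_1\mu_2=\mu_W` by the choice of \S\ref{ss:seesaw}; non-vanishing
> by Lemma~\ref{lem:chars}(b)), so for `f_j=\theta(\phi_j,\chi'_j)\in\Theta_j(\chi'_j)[\fp_+]` the adelic wedge
> `u_{f_1}\wedge u_{f_2}` of \S\ref{ss:forms} is one of the generators of `S_{12}` exhibited in the proof of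
> Lemma~\ref{lem:S12} (`u_{f_1}\wedge u_{f_2}=\vartheta_{T,\chi_{12}}(\mathrm{pr}_\kappa\Phi')`); by bilinearity the
> same holds for wedges of arbitrary elements of `\mathcal U_1` and `\mathcal U_2` (finite sums of generators). Hence
> if `u_1\wedge u_2\ne0` on `\mathbb B^2` for some `u_1\in\mathcal U_1`, `u_2\in\mathcal U_2`, then the corresponding
> element of `S_{12}` is a non-zero continuous function and `S_{12}\ne0`.

## Typing over the theta model (`HodgeCM.Universe.ThetaModel`, landed run 16)

Fix `T : U.ThetaModel`, a Hermitian space `V` over `(L, ι₁)` and a seesaw context `c` (types `Ψ = c.Ψ`, fixed lines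
`c.D`).  PerL's `𝒰_i` (l. 658) is the span of the `u_f`, `f ∈ Θ_i(χ'_i)[𝔭₊]`, `χ'_i` of type `e(Ψ_i)`; in the model
the `u_f` of type `Ψ_i` at level `Γ` are the set `T.Theta V c i Γ` (ThetaModel.lean field `Theta`, "Prop 4.3's
`u_f`"), so `𝒰_i` at level `Γ` is `Submodule.span ℂ (T.Theta V c i Γ)`; the adelic wedge `u₁ ∧ u₂` as an `L²`
function on `[G_U]` is `T.Λ Γ u₁ u₂ = T.emb Γ (u₁ ∪ u₂)` (`ThetaModel.Λ`), and "`u₁ ∧ u₂ ≠ 0` on `𝔹²`" is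
`U.cup2C _ 1 u₁ u₂ ≠ 0`.  The character `χ₁₂ = χ'₁ ⊠ χ'₂` of `[T]` has archimedean type `w`, i.e. is an element of
the index type `(T.t12 V c).X` (Perl34.TorusData: "characters χ of [T] with χ_∞ = w"), and "arises from an allowed
pair" is the predicate `(T.t12 V c).allowed` (whose docstring records that the lines and splitting characters are
FIXED, ll. 277–278, 304–314 — exactly the point of this node).  `S₁₂` is `(T.t12 V c).S12`, pinned by `S12_def` to
the closure of the span of the `ϑ_{T,χ}(Φ)` with `χ` allowed (ll. 348–349).

Rendering notes (not divergences): (R-a) "arbitrary elements of `𝒰₁`, `𝒰₂`" is rendered LEVEL-WISE (both in the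
spans at one level `Γ`, for every `Γ`) — any two elements of PerL's `𝒰₁`, `𝒰₂` are finite combinations of `u_f`'s
and live at a common level; this is also how the package consumes the statement (`ThetaRealisation.gen12`,
`lineField`).  (R-b) The model's `Theta` sets do not remember the character `χ'_i` of `f`, so the generator identity
`u_{f₁} ∧ u_{f₂} = ϑ_{T,χ₁₂}(pr_κ Φ')` is typed with `χ₁₂` and `Φ'` existentially quantified (`N33d_generatorIn`).

## What is proved here (kernel-checked, no new inputs)

* `bilin_span_span_mem` — the "by bilinearity … finite sums of generators" step, pure Mathlib.
* `N33d_membership` — INPUTS N31 (`N33d_allowedIn`) + N19-wedge (`N33d_generatorIn`) ⟹ every wedge of elements of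
  the spans lies in `S₁₂` (ll. 660–665).
* `N33d_nonzero` — INPUTS N33b (`N33d_holIn`: the `u_f` are holomorphic) + PRINT (`Fact_innerEmb`,
  `Fact_hodgeRiemann20`) + `ModelAxioms` ⟹ "if `u₁ ∧ u₂ ≠ 0` on `𝔹²` then the corresponding element of `S₁₂` is
  non-zero" (ll. 665–667); the `L²`-function is non-zero by Petersson = cup pairing and Hodge–Riemann in degree
  (2,0) (`ThetaModel.emb_ne_zero`, landed run 16).
* `N33d_statement`, `N33d_of` — the node as ONE proposition and its proof from the inputs above;
  `N33d_of_wedgeMem` — the same from the carver's coarser typing of N19 (`PerL34.N19w_wedgeMem` =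
  membership of the generators' wedges, which already folds the allowedness in).
* Consumers: `N33d_gen12` (the node gives the `gen12` field shape of `Universe.ThetaRealisation` / the body of the
  model input A7 in this context) and `N33d_lineField` (with N33e's output "some `u₁ ∧ u₂ ≠ 0`", ll. 680–681, it
  gives the `lineField` field shape AND `S₁₂ ≠ ⊥` — Prop 4.3's "in particular"; cf. `StubTree.prop43`).
-/

namespace HodgeCM
namespace PerL34

open HodgeCM.Prior.Perl34File

/-- **"By bilinearity the same holds for … finite sums of generators"** (PerL v5 l. 665), abstractly: if a bilinear
map sends `s × t` into a submodule `S`, it sends `span s × span t` into `S`. Pure Mathlib. -/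
theorem bilin_span_span_mem {M N P : Type*} [AddCommGroup M] [AddCommGroup N] [AddCommGroup P]
    [Module ℂ M] [Module ℂ N] [Module ℂ P] (B : M →ₗ[ℂ] N →ₗ[ℂ] P) {s : Set M} {t : Set N}
    (S : Submodule ℂ P) (h : ∀ x ∈ s, ∀ y ∈ t, B x y ∈ S) :
    ∀ x ∈ Submodule.span ℂ s, ∀ y ∈ Submodule.span ℂ t, B x y ∈ S := by
  intro x hx
  induction hx using Submodule.span_induction with
  | mem x hxs =>
    intro y hy
    induction hy using Submodule.span_induction with
    | mem y hyt => exact h x hxs y hyt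
    | zero => simp
    | add y₁ y₂ _ _ h₁ h₂ => simpa only [map_add] using S.add_mem h₁ h₂
    | smul a y _ hy' => simpa only [map_smul] using S.smul_mem a hy'
  | zero => intro y _; simp
  | add x₁ x₂ _ _ h₁ h₂ =>
    intro y hy
    simpa only [map_add, LinearMap.add_apply] using S.add_mem (h₁ y hy) (h₂ y hy)
  | smul a x _ hx' =>
    intro y hy
    simpa only [map_smul, LinearMap.smul_apply] using S.smul_mem a (hx' y hy)

variable {U : Universe} (T : U.ThetaModel)
variable {L : CMField} {ι₁ : L →+* ℂ} (V : HermSpace3 L ι₁) (c : SeesawCtx L)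

/-! ### Inputs of the node (earlier DAG nodes, typed; nothing is asserted) -/

/-- **INPUT = node N31's output for the FIXED lines** (PerL v5 Lemma 4.2(b), tex ll. 532–534, as used at
ll. 660–662: "Every pair `(\chi'_1,\chi'_2)` of such characters gives an allowed pair
`((W_1,\mu_1,\chi'_1),(W_2,\mu_2,\chi'_2))` for the FIXED lines and splitting characters (`\mu_1\mu_2=\mu_W` by the
choice of \S\ref{ss:seesaw}; non-vanishing by Lemma~\ref{lem:chars}(b))").  Typed: every character of `[T]` of type
`w` arises from an allowed pair of type (12) — the body of `IsolationSetting.H_chars12` / of the (12) half of the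
model input `ThetaModel.Open_chars` in this context. -/
def N33d_allowedIn : Prop :=
  ∀ χ : (T.t12 V c).X, (T.t12 V c).allowed χ

/-- **INPUT = node N19, wedge direction of Lemma 3.5, as invoked at ll. 662–664**: "for
`f_j=\theta(\phi_j,\chi'_j)\in\Theta_j(\chi'_j)[\fp_+]` the adelic wedge `u_{f_1}\wedge u_{f_2}` of \S\ref{ss:forms} is
one of the generators of `S_{12}` exhibited in the proof of Lemma~\ref{lem:S12}
(`u_{f_1}\wedge u_{f_2}=\vartheta_{T,\chi_{12}}(\mathrm{pr}_\kappa\Phi')`)" (proof of Lemma 3.5, ll. 372–375: seesaw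
identity (eq:seesaw) + Lemma 3.4).  Typed with `χ₁₂ ∈ X` and `Φ' ∈ 𝒮^κ` existential (rendering note R-b). -/
def N33d_generatorIn : Prop :=
  ∀ (Γ : Level V), ∀ ω₁ ∈ T.Theta V c 0 Γ, ∀ ω₂ ∈ T.Theta V c 1 Γ,
    ∃ χ : (T.t12 V c).X, ∃ Φ : T.SK V c, T.Λ Γ ω₁ ω₂ = (T.t12 V c).ϑ χ Φ

/-- **INPUT = the carver's typing of N19 (wedge direction), specialised to this context**: the wedge-function of
two theta one-forms of types `Ψ₀, Ψ₁` lies in `S₁₂` (the body of `PerL34.N19w_wedgeMem` = model input A7 at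
`(V, c)`; it folds N31's allowedness in).  Used only by `N33d_of_wedgeMem`. -/
def N33d_wedgeMemIn : Prop :=
  ∀ (Γ : Level V) (ω₁ ω₂ : U.CohC (U.pms L ι₁ V Γ) 1), ω₁ ∈ T.Theta V c 0 Γ → ω₂ ∈ T.Theta V c 1 Γ →
    T.Λ Γ ω₁ ω₂ ∈ (T.t12 V c).S12

/-- **INPUT = node N33b's output** (PerL v5 ll. 650–655: "the `\tau`-valued function
`g_{\iota_1}\mapsto(f^1,f^2)(g_{\iota_1},1,\dots,1;1_f)` … is a holomorphic `1`-form `u_f` on `\mathbb B^2`").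
Typed: the theta one-forms are classes of Hodge type (1,0).  In the package it follows from node N12 / model input
A5 (`Theta ⊆ U_Ψ`) and `Universe.Uiso_le_H10`, see `N33d_holIn_of_sub`. -/
def N33d_holIn : Prop :=
  ∀ (i : Fin 4) (Γ : Level V), T.Theta V c i Γ ⊆ U.H10 (U.pms L ι₁ V Γ)

/-- `N33d_holIn` from the isotypic typing `Θ_i(Γ) ⊆ U_{Ψ_i}(Γ)` (node N12 / the body of model input A5 in this
context) and `U_Ψ ⊆ H^{1,0}` (`Universe.Uiso_le_H10`, uses `ModelAxioms.pull_hodge`). -/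
theorem N33d_holIn_of_sub (M : U.ModelAxioms)
    (hsub : ∀ (i : Fin 4) (Γ : Level V), T.Theta V c i Γ ⊆ U.Uiso Γ c.K (c.Ψ i) c.σ) :
    N33d_holIn T V c :=
  fun i Γ _ hω => U.Uiso_le_H10 M.pull_hodge Γ c.K (c.Ψ i) c.σ (hsub i Γ hω)

/-! ### The node -/

/-- **N33d, first half (ll. 660–665): every wedge of elements of `𝒰₁ = span Θ₀(Γ)` and `𝒰₂ = span Θ₁(Γ)` lies in
`S₁₂`.**  Proof as in PerL: a wedge of generators is `ϑ_{T,χ₁₂}(Φ')` (N19-wedge) with `χ₁₂` allowed (N31), hence a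
generator of `S₁₂` (`S12_def`, ll. 348–349); then bilinearity (`bilin_span_span_mem`). -/
theorem N33d_membership (h31 : N33d_allowedIn T V c) (h19 : N33d_generatorIn T V c) (Γ : Level V) :
    ∀ u₁ ∈ Submodule.span ℂ (T.Theta V c 0 Γ), ∀ u₂ ∈ Submodule.span ℂ (T.Theta V c 1 Γ),
      T.Λ Γ u₁ u₂ ∈ (T.t12 V c).S12 := by
  refine bilin_span_span_mem (T.Λ Γ) (T.t12 V c).S12 ?_
  intro ω₁ h₁ ω₂ h₂
  obtain ⟨χ, Φ, hgen⟩ := h19 Γ ω₁ h₁ ω₂ h₂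
  rw [hgen, (T.t12 V c).S12_def]
  exact Submodule.le_topologicalClosure _ (Submodule.subset_span ⟨χ, h31 χ, Φ, rfl⟩)

/-- The generators' wedges lie in `S₁₂` (the carver's N19w shape at `(V, c)`) — from N31 + N19-wedge. -/
theorem N33d_wedgeMem_of (h31 : N33d_allowedIn T V c) (h19 : N33d_generatorIn T V c) :
    N33d_wedgeMemIn T V c :=
  fun Γ ω₁ ω₂ h₁ h₂ =>
    N33d_membership T V c h31 h19 Γ ω₁ (Submodule.subset_span h₁) ω₂ (Submodule.subset_span h₂)

/-- First half again, from the coarser input `N33d_wedgeMemIn` alone (bilinearity only). -/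
theorem N33d_membership' (hw : N33d_wedgeMemIn T V c) (Γ : Level V) :
    ∀ u₁ ∈ Submodule.span ℂ (T.Theta V c 0 Γ), ∀ u₂ ∈ Submodule.span ℂ (T.Theta V c 1 Γ),
      T.Λ Γ u₁ u₂ ∈ (T.t12 V c).S12 :=
  bilin_span_span_mem (T.Λ Γ) (T.t12 V c).S12 fun ω₁ h₁ ω₂ h₂ => hw Γ ω₁ ω₂ h₁ h₂

/-- **N33d, second half (ll. 665–667): "if `u₁ ∧ u₂ ≠ 0` on `𝔹²` … the corresponding element of `S₁₂` is a
non-zero continuous function".**  The `u_j` are holomorphic (N33b), so `u₁ ∪ u₂ ∈ F²H²` (`cup2C_mem_F2`), and a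
non-zero class in `F²H²` of the surface `P_Γ` has non-zero `L²` function (`ThetaModel.emb_ne_zero`: Petersson =
cup pairing, PRINT `Fact_innerEmb`; Hodge–Riemann in degree (2,0), PRINT `Fact_hodgeRiemann20`). -/
theorem N33d_nonzero (M : U.ModelAxioms) (hI : T.Fact_innerEmb) (hHR : U.Fact_hodgeRiemann20)
    (hhol : N33d_holIn T V c) (Γ : Level V) {u₁ u₂ : U.CohC (U.pms L ι₁ V Γ) 1}
    (hu₁ : u₁ ∈ Submodule.span ℂ (T.Theta V c 0 Γ)) (hu₂ : u₂ ∈ Submodule.span ℂ (T.Theta V c 1 Γ))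
    (hne : U.cup2C (U.pms L ι₁ V Γ) 1 u₁ u₂ ≠ 0) : T.Λ Γ u₁ u₂ ≠ 0 := by
  have h10 : ∀ i : Fin 4, Submodule.span ℂ (T.Theta V c i Γ) ≤ U.H10 (U.pms L ι₁ V Γ) :=
    fun i => Submodule.span_le.mpr (hhol i Γ)
  rw [T.Λ_apply]
  exact T.emb_ne_zero M hI hHR Γ (Universe.cup2C_mem_F2 M _ (h10 0 hu₁) (h10 1 hu₂)) hne

/-- **NODE N33d as one proposition** (PerL v5 Prop 4.3 proof, tex ll. 660–667), over the theta model at `(V, c)`: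
(1) for every level `Γ`, every wedge of elements of `𝒰₁ = span Θ₀(Γ)` and `𝒰₂ = span Θ₁(Γ)` lies in `S₁₂`;
(2) if such a wedge is non-zero as a class (`u₁ ∧ u₂ ≠ 0` on `𝔹²`), the corresponding element of `S₁₂` is non-zero
and `S₁₂ ≠ 0`. -/
def N33d_statement : Prop :=
  (∀ (Γ : Level V), ∀ u₁ ∈ Submodule.span ℂ (T.Theta V c 0 Γ), ∀ u₂ ∈ Submodule.span ℂ (T.Theta V c 1 Γ),
      T.Λ Γ u₁ u₂ ∈ (T.t12 V c).S12) ∧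
  (∀ (Γ : Level V), ∀ u₁ ∈ Submodule.span ℂ (T.Theta V c 0 Γ), ∀ u₂ ∈ Submodule.span ℂ (T.Theta V c 1 Γ),
      U.cup2C (U.pms L ι₁ V Γ) 1 u₁ u₂ ≠ 0 → T.Λ Γ u₁ u₂ ≠ 0 ∧ (T.t12 V c).S12 ≠ ⊥)

/-- **N33d PROVED from its DAG inputs**: N31 (`N33d_allowedIn`), N19-wedge (`N33d_generatorIn`), N33b
(`N33d_holIn`), the PRINT facts `Fact_innerEmb` ([BW] VII Thm 3.2 / Matsushima) and `Fact_hodgeRiemann20` (Voisin I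
Thm 6.32), and `ModelAxioms` (`cup2_hodge`, `pms_dim`). -/
theorem N33d_of (M : U.ModelAxioms) (hI : T.Fact_innerEmb) (hHR : U.Fact_hodgeRiemann20)
    (h31 : N33d_allowedIn T V c) (h19 : N33d_generatorIn T V c) (hhol : N33d_holIn T V c) :
    N33d_statement T V c := by
  refine ⟨fun Γ => N33d_membership T V c h31 h19 Γ, fun Γ u₁ hu₁ u₂ hu₂ hne => ?_⟩
  have hΛ : T.Λ Γ u₁ u₂ ≠ 0 := N33d_nonzero T V c M hI hHR hhol Γ hu₁ hu₂ hne
  refine ⟨hΛ, fun hbot => hΛ ?_⟩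
  have hmem := N33d_membership T V c h31 h19 Γ u₁ hu₁ u₂ hu₂
  rw [hbot, Submodule.mem_bot] at hmem
  exact hmem

/-- **N33d PROVED from the carver's coarser N19 typing** (`N33d_wedgeMemIn` = `PerL34.N19w_wedgeMem` at `(V, c)`)
+ N33b + PRINT + `ModelAxioms`. -/
theorem N33d_of_wedgeMem (M : U.ModelAxioms) (hI : T.Fact_innerEmb) (hHR : U.Fact_hodgeRiemann20)
    (hw : N33d_wedgeMemIn T V c) (hhol : N33d_holIn T V c) : N33d_statement T V c := by
  refine ⟨fun Γ => N33d_membership' T V c hw Γ, fun Γ u₁ hu₁ u₂ hu₂ hne => ?_⟩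
  have hΛ : T.Λ Γ u₁ u₂ ≠ 0 := N33d_nonzero T V c M hI hHR hhol Γ hu₁ hu₂ hne
  refine ⟨hΛ, fun hbot => hΛ ?_⟩
  have hmem := N33d_membership' T V c hw Γ u₁ hu₁ u₂ hu₂
  rw [hbot, Submodule.mem_bot] at hmem
  exact hmem

/-! ### Consumers (how the node feeds N33 = Prop 4.3 and the realisation record) -/

/-- From N33d: the `gen12` field shape of `Universe.ThetaRealisation` (= the body of model input A7 at `(V, c)`). -/
theorem N33d_gen12 (h : N33d_statement T V c) : N33d_wedgeMemIn T V c :=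
  fun Γ ω₁ ω₂ h₁ h₂ => h.1 Γ ω₁ (Submodule.subset_span h₁) ω₂ (Submodule.subset_span h₂)

/-- **Prop 4.3, last sentence (tex ll. 680–681): "So some `u_1\wedge u_2\ne0` with `u_j\in\mathcal U_j`, and
`S_{12}\ne0` by the previous paragraph."**  From N33d and N33e's output (a non-zero wedge of theta one-forms at some
level, the body of model input A6 at `(V, c)`): the `lineField` field shape of `Universe.ThetaRealisation` (a
non-zero wedge-FUNCTION) and `S₁₂ ≠ ⊥`. -/
theorem N33d_lineField (h : N33d_statement T V c)
    (h33e : ∃ Γ : Level V, ∃ ω₁ ∈ T.Theta V c 0 Γ, ∃ ω₂ ∈ T.Theta V c 1 Γ,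
      U.cup2C (U.pms L ι₁ V Γ) 1 ω₁ ω₂ ≠ 0) :
    (∃ Γ : Level V, ∃ ω₁ ∈ T.Theta V c 0 Γ, ∃ ω₂ ∈ T.Theta V c 1 Γ, T.Λ Γ ω₁ ω₂ ≠ 0) ∧
      (T.t12 V c).S12 ≠ ⊥ := by
  obtain ⟨Γ, ω₁, h₁, ω₂, h₂, hne⟩ := h33e
  have h2 := h.2 Γ ω₁ (Submodule.subset_span h₁) ω₂ (Submodule.subset_span h₂) hne
  exact ⟨⟨Γ, ω₁, h₁, ω₂, h₂, h2.1⟩, h2.2⟩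

end PerL34
end HodgeCM
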